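import Mathlib
import Summits.Ventures.PercRepro2.SwOutMultiRootECube
import Summits.Ventures.PercRepro2.SwOutCoreCube
import Summits.Ventures.PercRepro2.SwOutArmGTyped

/-!
# The multi-root core cube with root–root edges: the edge sets, the flip and the inequality
(blind cell PercRepro2, night-4 g34, 2026-08-29; proofs/NIGHT4-G34.md §8)

The red edge set of `h` is increasing in the cube point and the blue one decreasing, the flip of
the cube (every arm and every root–root edge) exchanges the red and the blue clusters and edge
sets of a root, the cube stays in the class, the general doubly typed side pulls back to a lower
set, the realisation is injective, and the rigid counting inequality holds on `gTypedQ` over the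
cube `coreCubeRR`: **`MultiBaseE.card_coreCubeRR_le_g`** (g10's `card_le_of_cube_edges` on the
cube `Config (ι ⊕ ↥RR)`).
-/

namespace Summit.Ventures.PercRepro2

namespace LocRows

open Hull

variable {V : Type*} {E : Type*}

open scoped Classical

variable {ends : E → Sym2 V}

section CubeDef

variable [Fintype E] [DecidableEq E] {ι : Type*} [Fintype ι]

variable (ends) in
/-- The cube with root–root coordinates: the realisations of all cube points. -/
noncomputable def coreCubeRR (A : ι → Set V) (RR : Finset E) (ζ : Config E) : Finset (Config E) :=
  Finset.univ.image (coreRealRR ends A RR ζ)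

/-- Membership in the cube. -/
lemma mem_coreCubeRR {A : ι → Set V} {RR : Finset E} {ζ ζ' : Config E} :
    ζ' ∈ coreCubeRR ends A RR ζ ↔ ∃ ω, coreRealRR ends A RR ζ ω = ζ' := by
  simp only [coreCubeRR, Finset.mem_image, Finset.mem_univ, true_and]

end CubeDef

section Ineq

variable {ι : Type*} {A : ι → Set V} {ζ : Config E} {R H : Set V} {RR : Finset E} {h : V}
  (hb : MultiBaseE ends ζ R H A RR)
include hb

/-- **The red edge set of `h` is increasing in the cube point.** -/
theorem MultiBaseE.redEdges_coreRealRR_mono (hh : h ∈ R) {ω ω' : Config (ι ⊕ ↥RR)} (hω : ω ≤ ω') :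
    redEdges ends (coreRealRR ends A RR ζ ω) h ⊆ redEdges ends (coreRealRR ends A RR ζ ω') h := by
  rintro e ⟨he, hw⟩
  exact ⟨hb.coreRealRR_le_of_within_true hω (hb.within_cluster_subset hh ω hw) he,
    within_mono (hb.cluster_coreRealRR_mono hh hω) hw⟩

/-- **The blue edge set of `h` is decreasing in the cube point.** -/
theorem MultiBaseE.blueEdges_coreRealRR_anti (hh : h ∈ R) {ω ω' : Config (ι ⊕ ↥RR)} (hω : ω ≤ ω') :
    blueEdges ends (coreRealRR ends A RR ζ ω') h ⊆ blueEdges ends (coreRealRR ends A RR ζ ω) h := by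
  rintro e ⟨he, hw⟩
  refine ⟨?_, within_mono (hb.cluster_blue_coreRealRR_anti hh hω) hw⟩
  rw [blue_eq_true_iff] at he ⊢
  exact hb.coreRealRR_blue_of_within_false hω (hb.within_cluster_blue_subset hh ω' hw) he

/-! ### The flip of the cube -/

/-- The flipped cube point negates every edge touching an arm or joining two roots. -/
lemma MultiBaseE.coreRealRR_flipAll_apply {ω : Config (ι ⊕ ↥RR)} {e : E}
    (he : e ∈ touches ends (allArms A) ∨ e ∈ RR) :
    coreRealRR ends A RR ζ (flipAll ω) e = !coreRealRR ends A RR ζ ω e := by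
  by_cases hrr : e ∈ RR
  · rw [coreRealRR_apply_rr hrr, coreRealRR_apply_rr hrr]
    by_cases hi : ω (Sum.inr ⟨e, hrr⟩) = true
    · have : flipAll ω (Sum.inr ⟨e, hrr⟩) ≠ true := by simp [flipAll, hi]
      rw [if_neg this, if_pos hi]
    · have : flipAll ω (Sum.inr ⟨e, hrr⟩) = true := by simp [flipAll]; simpa using hi
      rw [if_pos this, if_neg hi, Bool.not_not]
  · have ht : e ∈ touches ends (allArms A) := by
      rcases he with he | he
      · exact he
      · exact absurd he hrr
    obtain ⟨i, x, y, hxy, hx⟩ := MultiBaseE.exists_arm_of_touches_allArms ht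
    rw [hb.coreRealRR_apply_of_mem hxy hx, hb.coreRealRR_apply_of_mem hxy hx]
    by_cases hi : ω (Sum.inl i) = true
    · have : flipAll ω (Sum.inl i) ≠ true := by simp [flipAll, hi]
      rw [if_neg this, if_pos hi]
    · have : flipAll ω (Sum.inl i) = true := by simp [flipAll]; simpa using hi
      rw [if_pos this, if_neg hi, Bool.not_not]

/-- An edge inside `H` touches an arm or joins two roots. -/
lemma MultiBaseE.touches_or_rr_of_within {e : E} (he : e ∈ within ends H) :
    e ∈ touches ends (allArms A) ∨ e ∈ RR := by
  obtain ⟨x, hx, y, hy, hxy⟩ := he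
  by_cases hxR : x ∈ R
  · by_cases hyR : y ∈ R
    · exact Or.inr (hb.mem_rr hxR hyR hxy)
    · obtain ⟨i, hi⟩ := hb.arm_cover y hy hyR
      exact Or.inl ⟨y, ⟨i, hi⟩, x, ends_swap hxy⟩
  · obtain ⟨i, hi⟩ := hb.arm_cover x hx hxR
    exact Or.inl ⟨x, ⟨i, hi⟩, y, hxy⟩

/-- **The flip of the cube exchanges the red and the blue clusters of a root.** -/
theorem MultiBaseE.cluster_blue_coreRealRR_flipAll {r : V} (hr : r ∈ R) (ω : Config (ι ⊕ ↥RR)) :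
    cluster ends (blue (coreRealRR ends A RR ζ (flipAll ω))) r =
      cluster ends (coreRealRR ends A RR ζ ω) r := by
  have hsub : within ends (R ∪ armsTrueC A (armPart ω)) ⊆ within ends H := by
    rintro e ⟨x, hx, y, hy, hxy⟩
    have key : ∀ z, z ∈ R ∪ armsTrueC A (armPart ω) → z ∈ H := by
      rintro z (hz | ⟨i, _, hz⟩)
      · exact hb.root_sub hz
      · exact (hb.arm_sub i z hz).1
    exact ⟨x, key x hx, y, key y hy, hxy⟩
  have hag : ∀ e ∈ within ends (R ∪ armsTrueC A (armPart ω)),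
      blue (coreRealRR ends A RR ζ (flipAll ω)) e = coreRealRR ends A RR ζ ω e := by
    intro e he
    rw [blue_apply, hb.coreRealRR_flipAll_apply (hb.touches_or_rr_of_within (hsub he)),
      Bool.not_not]
  have hflip : armsFalseC A (armPart (flipAll ω)) = armsTrueC A (armPart ω) := by
    ext x; simp [armsFalseC, armsTrueC, armPart, flipAll]
  apply Set.Subset.antisymm
  · refine cluster_subset_of_le_within (S := R ∪ armsTrueC A (armPart ω)) ?_ (Or.inl hr)
      (fun e he h' => by rw [← hag e he]; exact h')
    intro x hx y hxy
    have := hb.blue_closed (flipAll ω) (x := x) (y := y) (by rwa [hflip]) hxy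
    rwa [hflip] at this
  · exact cluster_subset_of_le_within (S := R ∪ armsTrueC A (armPart ω))
      (fun _ hx _ hxy => hb.red_closed ω hx hxy) (Or.inl hr)
      (fun e he h' => by rw [hag e he]; exact h')

/-- **The flip of the cube exchanges the red and the blue edge sets of `h`.** -/
theorem MultiBaseE.blueEdges_coreRealRR_flipAll (hh : h ∈ R) (ω : Config (ι ⊕ ↥RR)) :
    blueEdges ends (coreRealRR ends A RR ζ (flipAll ω)) h =
      redEdges ends (coreRealRR ends A RR ζ ω) h := by
  ext e
  simp only [blueEdges, mem_redEdges, hb.cluster_blue_coreRealRR_flipAll hh ω]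
  have hsub : within ends (cluster ends (coreRealRR ends A RR ζ ω) h) ⊆ within ends H :=
    within_mono (fun x hx => hb.hull_subset ω hh (Or.inl hx))
  constructor
  · rintro ⟨he, hw⟩
    refine ⟨?_, hw⟩
    rw [blue_apply, hb.coreRealRR_flipAll_apply (hb.touches_or_rr_of_within (hsub hw)),
      Bool.not_not] at he
    exact he
  · rintro ⟨he, hw⟩
    refine ⟨?_, hw⟩
    rw [blue_apply, hb.coreRealRR_flipAll_apply (hb.touches_or_rr_of_within (hsub hw)),
      Bool.not_not]
    exact he

/-! ### The class, the side, the injectivity and the inequality -/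

/-- **The cube stays in the class** (`H ⊆ U`, the base in the class). -/
theorem MultiBaseE.coreRealRR_mem_outClass [Fintype E] [DecidableEq E] {U : Set V} {ξ : Config E}
    (hh : h ∈ R) (hHU : H ⊆ U) (hcl : ζ ∈ outClass ends U h ξ) (ω : Config (ι ⊕ ↥RR)) :
    coreRealRR ends A RR ζ ω ∈ outClass ends U h ξ := by
  rw [mem_outClass] at hcl ⊢
  refine ⟨fun e he => ?_, (hb.hull_subset ω hh).trans hHU⟩
  rw [← hcl.1 e he]
  apply MultiBaseE.coreRealRR_apply_of_notMem
  · intro ht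
    apply he
    obtain ⟨x, ⟨i, hx⟩, y, hxy⟩ := ht
    exact ⟨x, hHU (hb.arm_sub i x hx).1, y, hxy⟩
  · intro hrr
    apply he
    obtain ⟨r, hr, r', -, hrr'⟩ := (hb.rr_iff e).1 hrr
    exact ⟨r, hHU (hb.root_sub hr), r', hrr'⟩

/-- **The general doubly typed side pulls back to a lower set of the cube** (`l` and `X` outside
`H`). -/
theorem MultiBaseE.coreRealRR_mem_gTypedQ_of_le [Fintype E] [DecidableEq E] {l : V}
    {𝓤 𝓓 𝓓'' : Set (Set V)} {X : Set V} {𝓤' : Set (Set V)} (hh : h ∈ R) (h𝓤 : IsUpperSet 𝓤)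
    (h𝓓 : IsLowerSet 𝓓) (h𝓓'' : IsLowerSet 𝓓'') (h𝓤' : IsUpperSet 𝓤') (hl : l ∉ H)
    (hX : ∀ x ∈ X, x ∉ H) {ω ω' : Config (ι ⊕ ↥RR)} (hω : ω ≤ ω')
    (hQ : coreRealRR ends A RR ζ ω' ∈ gTypedQ ends l h 𝓤 𝓓 𝓓'' X 𝓤') :
    coreRealRR ends A RR ζ ω ∈ gTypedQ ends l h 𝓤 𝓓 𝓓'' X 𝓤' := by
  rw [mem_gTypedQ] at hQ ⊢
  obtain ⟨-, hA, hB, hRh, -, hBh⟩ := hQ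
  refine ⟨?_, h𝓤 (hb.cluster_out_coreRealRR_anti hl hω) hA,
    h𝓓 (hb.cluster_blue_out_coreRealRR_mono hl hω) hB,
    h𝓓'' (hb.cluster_coreRealRR_mono hh hω) hRh, ?_,
    h𝓤' (hb.cluster_blue_coreRealRR_anti hh hω) hBh⟩
  · rintro (hhl | hhl)
    · exact (hb.root_notMem_cluster_out ω hl hh).1 hhl
    · exact (hb.root_notMem_cluster_out ω hl hh).2 hhl
  · intro x hx hxH
    exact hX x hx (hb.hull_subset ω hh hxH)

/-- **The realisation is injective.** -/
theorem MultiBaseE.coreRealRR_injective : Function.Injective (coreRealRR ends A RR ζ) := by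
  intro ω ω' heq
  funext i
  rcases i with i | ⟨e, he⟩
  · obtain ⟨x, hx⟩ := hb.arm_nonempty i
    obtain ⟨r, hr, hxr⟩ := hb.conn i x hx
    have hxe : ∃ e, x ∈ ends e :=
      exists_edge_of_mem_cluster (h := r) hxr (fun h' => (hb.arm_sub i x hx).2 (h' ▸ hr))
    obtain ⟨e, hxe⟩ := hxe
    have hxy : ends e = s(x, Sym2.Mem.other hxe) := (Sym2.other_spec hxe).symm
    have h1 := hb.coreRealRR_apply_of_mem (ω := ω) hxy hx
    have h2 := hb.coreRealRR_apply_of_mem (ω := ω') hxy hx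
    rw [heq] at h1
    rw [h1] at h2
    by_contra hne
    have key : ∀ b b' : Bool, b ≠ b' →
        (if b = true then ζ e else !ζ e) ≠ (if b' = true then ζ e else !ζ e) := by
      intro b b' hbb'
      cases b <;> cases b' <;> simp at hbb' ⊢
    exact key _ _ hne h2
  · have h1 := hb.coreRealRR_rr_edge (ω := ω) he
    have h2 := hb.coreRealRR_rr_edge (ω := ω') he
    rw [heq] at h1
    by_contra hne
    cases hω : ω (Sum.inr ⟨e, he⟩) with
    | true =>
      have := h2.1 (h1.2 hω)
      rw [hω] at hne; exact hne this.symm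
    | false =>
      have h3 : ω' (Sum.inr ⟨e, he⟩) ≠ true := fun h' => by
        have := h1.1 (h2.2 h'); rw [hω] at this; simp at this
      have h3' : ω' (Sum.inr ⟨e, he⟩) = false := Bool.eq_false_iff.mpr h3
      rw [hω, h3'] at hne; exact hne rfl

/-- **THE MULTI-ROOT CUBE INEQUALITY WITH ROOT–ROOT EDGES, GENERAL DOUBLY TYPED SIDE.** -/
theorem MultiBaseE.card_coreCubeRR_le_g [Fintype E] [DecidableEq E] [Fintype ι] {U : Set V} {l : V}
    {𝓤 𝓓 𝓓'' : Set (Set V)} {X : Set V} {𝓤' : Set (Set V)} (hh : h ∈ R) (h𝓤 : IsUpperSet 𝓤)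
    (h𝓓 : IsLowerSet 𝓓) (h𝓓'' : IsLowerSet 𝓓'') (h𝓤' : IsUpperSet 𝓤') (hHU : H ⊆ U) (hl : l ∉ U)
    (hX : ∀ x ∈ X, x ∉ H) {𝓔 : Set (Set E)} (h𝓔 : IsUpperSet 𝓔) :
    ((coreCubeRR ends A RR ζ).filter fun ζ' =>
        ζ' ∈ gTypedQ ends l h 𝓤 𝓓 𝓓'' X 𝓤' ∧ redEdges ends ζ' h ∈ 𝓔).card ≤
      ((coreCubeRR ends A RR ζ).filter fun ζ' =>
        ζ' ∈ gTypedQ ends l h 𝓤 𝓓 𝓓'' X 𝓤' ∧ blueEdges ends ζ' h ∈ 𝓔).card := by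
  have hlH : l ∉ H := fun h' => hl (hHU h')
  have key := card_le_of_cube_edges (ends := ends) (coreRealRR ends A RR ζ) hb.coreRealRR_injective
    (coreCubeRR ends A RR ζ) (fun ζ' => mem_coreCubeRR)
    (↑(gTypedQ ends l h 𝓤 𝓓 𝓓'' X 𝓤'))
    (fun ω' ω hω hQ => hb.coreRealRR_mem_gTypedQ_of_le hh h𝓤 h𝓓 h𝓓'' h𝓤' hlH hX hω hQ) h
    (fun 𝓔' h𝓔' ω ω' hω hω𝓔 => h𝓔' (hb.redEdges_coreRealRR_mono hh hω) hω𝓔)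
    (fun 𝓔' h𝓔' ω' ω hω hω𝓔 => h𝓔' (hb.blueEdges_coreRealRR_anti hh hω) hω𝓔)
    (fun ω => hb.blueEdges_coreRealRR_flipAll hh ω) h𝓔
  simpa only [Finset.mem_coe] using key

end Ineq

end LocRows

end Summit.Ventures.PercRepro2
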